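import Summits.ValiantsHypothesis.ValiantsHypothesis.Theorems.BarrierLeverAnchoredDoorHitsLowerPairsDTPeel

/-!
# Support item `AnchoredDoorHitsLowerPairs` (stmt-ValiantsHypothesis-22510), line `anchored-peeling`:
# the DECOMPOSING DT-STAGE (DTS), part 1 — first-fit keys of rows and columns

Helper file (`--supports stmt-ValiantsHypothesis-22510`; cell valiant-natproofs, rung V4, 𝒟-side door (c); registered line
`Cruxes/AnchoredDoorHitsLowerPairs/Lines/anchored_peeling.lean` v10; prover seat val-np-p1 gen 18). Definition-light (bookkeeping
`def`s `stamp`, `rowKey`, `stampsIn`, `colKey`, `peelU`, `peelE` only). Closes NO item.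

THE DEVICE (memo HOME/val-np-p1/g18/DTS-MEMO-valnp1-g18.md). Peel ONE `x`-vertex `a` of the layout `(u, w)` with a type list
`(B_j, c_j, D_j)_{j<J}` (DT-peel lemma, `…DTPeel`, p595283) and put `E_j := {c_j} ⊔ D_j` (the STAMP of type `j`). A link row
`S ∋ a` of class `j` (FIRST FIT: the first `j` with `B_j ⊆ S ∖ a`) becomes the generalized row `(S ∖ a ∖ B_j | E_j)`, whose entry at a
column `T` is `[E_j ⊆ T] · [x^{S∖a∖B_j} y^{T∖E_j}] 𝔄_s`; deletion rows `S ∌ a` keep `(S | ∅)`. Give every COLUMN its first-fit key too: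
the first `j` with `E_j ⊆ T` (key `J` if none), and every row the key `cls` (key `J` for deletion rows). A peeled entry is nonzero only
if `colKey T ≤ rowKey S`. HYPOTHESIS (the DTS size condition): for every `j < J` the number of link rows of class `j` equals the number
of columns of key `j`. Then a permutation of the columns aligns the keys, the peeled matrix is BLOCK-TRIANGULAR
(`Matrix.BlockTriangular.det`), and its diagonal blocks are the layout matrices of
* the DELETION PAIR `({S ∈ R : a ∉ S}, {T ∈ C : no E_j ⊆ T})`, and
* for each `j`, the SHIFTED CLASS PAIR `(𝒰_j, C'_j)`, `𝒰_j = {S ∖ a ∖ B_j : S ∈ R of class j}`, `C'_j = {T ∖ E_j : T ∈ C of key j}`.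

THIS FILE: the keys (`rowKey`, `colKey`), the peeled rows (`peelU`, `peelE`), the support lemma `colKey_le_rowKey_of_ne_zero`, and the
fibre count `card_rowKey_eq_card_colKey` (the size condition for `j < J` forces it for the deletion key `J` as well). The sequel
`…DTSStep` builds the aligning permutation, proves block-triangularity and identifies the diagonal blocks
(`symbolicDet_ne_zero_of_dtsStep`); `…DTSStub` states the DTS CONJECTURE and proves DTS ⟹ U1 ⟹ the item.

WHAT THIS IS NOT: no claim that a decomposing stage exists in general; nothing on items 22510 / 19717 themselves, on crux
stmt-ValiantsHypothesis-14610 or on `VP` versus `VNP`.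
-/

set_option linter.dupNamespace false

namespace Summit.ValiantsHypothesis.ValiantsHypothesis.Theorems.BarrierLever.AnchoredPeeling

open Finset MvPolynomial
open Summit.ValiantsHypothesis.ValiantsHypothesis.Theorems.BarrierLever.BrickCalculus (pexpo pexpo_def)

noncomputable section

namespace DTPeel

variable {h : ℕ}

section DTS

variable {r J : ℕ} (u w : Fin r → Finset (Fin h)) (a : Fin h) (B : Fin J → Finset (Fin h)) (c : Fin J → Fin h)
  (D : Fin J → Finset (Fin h)) (cls : Fin r → Fin J)

/-! ## 1. Stamps, keys, peeled rows -/

/-- The stamp `E_j = {c_j} ⊔ D_j` of type `j`. -/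
def stamp (j : Fin J) : Finset (Fin h) := insert (c j) (D j)

/-- Row key: the class of a link row (as a natural number), `J` for a deletion row. -/
def rowKey (i : Fin r) : ℕ := if a ∈ u i then (cls i : ℕ) else J

/-- The types whose stamp lies in the column `w k`. -/
def stampsIn (k : Fin r) : Finset (Fin J) := univ.filter fun j => stamp c D j ⊆ w k

/-- Column key: the FIRST type whose stamp lies in the column, `J` if there is none. -/
def colKey (k : Fin r) : ℕ :=
  if hk : (stampsIn w c D k).Nonempty then ((stampsIn w c D k).min' hk : ℕ) else J

/-- The peeled `x`-sets. -/
def peelU (i : Fin r) : Finset (Fin h) := if a ∈ u i then ((u i).erase a) \ B (cls i) else u i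

/-- The peeled `y`-shifts (written exactly as the DT-peel lemma produces them from empty shifts). -/
def peelE (i : Fin r) : Finset (Fin h) := if a ∈ u i then (∅ : Finset (Fin h)) ∪ insert (c (cls i)) (D (cls i)) else ∅

variable {u w a B c D cls}

/-- A link row has key its class. -/
theorem rowKey_of_mem {i : Fin r} (hi : a ∈ u i) : rowKey u a cls i = cls i := by
  rw [rowKey, if_pos hi]

/-- A deletion row has key `J`. -/
theorem rowKey_of_not_mem {i : Fin r} (hi : a ∉ u i) : rowKey u a cls i = J := by
  rw [rowKey, if_neg hi]

/-- Row keys are at most `J`. -/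
theorem rowKey_le (i : Fin r) : rowKey u a cls i ≤ J := by
  by_cases hi : a ∈ u i
  · rw [rowKey_of_mem hi]; exact (cls i).2.le
  · rw [rowKey_of_not_mem hi]

/-- Key `J` characterises the deletion rows. -/
theorem rowKey_eq_J_iff (i : Fin r) : rowKey u a cls i = J ↔ a ∉ u i := by
  constructor
  · intro hk hi
    rw [rowKey_of_mem hi] at hk
    exact absurd hk (cls i).2.ne
  · exact rowKey_of_not_mem

/-- Key `j < J` characterises the link rows of class `j`. -/
theorem rowKey_eq_iff (i : Fin r) (j : Fin J) : rowKey u a cls i = j ↔ a ∈ u i ∧ cls i = j := by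
  constructor
  · intro hk
    by_cases hi : a ∈ u i
    · rw [rowKey_of_mem hi] at hk
      exact ⟨hi, Fin.ext hk⟩
    · rw [rowKey_of_not_mem hi] at hk
      exact absurd hk.symm j.2.ne
  · rintro ⟨hi, rfl⟩
    exact rowKey_of_mem hi

/-- Membership in `stampsIn`. -/
theorem mem_stampsIn {k : Fin r} {j : Fin J} : j ∈ stampsIn w c D k ↔ stamp c D j ⊆ w k := by
  rw [stampsIn, Finset.mem_filter]
  exact ⟨fun hj => hj.2, fun hj => ⟨Finset.mem_univ _, hj⟩⟩

/-- Column keys are at most `J`. -/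
theorem colKey_le (k : Fin r) : colKey w c D k ≤ J := by
  rw [colKey]
  split_ifs with hk
  · exact ((stampsIn w c D k).min' hk).2.le
  · exact le_rfl

/-- A column containing the stamp of type `j` has key at most `j`. -/
theorem colKey_le_of_subset {k : Fin r} {j : Fin J} (hj : stamp c D j ⊆ w k) : colKey w c D k ≤ j := by
  have hmem : j ∈ stampsIn w c D k := mem_stampsIn.mpr hj
  have hk : (stampsIn w c D k).Nonempty := ⟨j, hmem⟩
  rw [colKey, dif_pos hk]
  exact_mod_cast Finset.min'_le _ _ hmem

/-- Key `J` characterises the columns containing no stamp. -/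
theorem colKey_eq_J_iff (k : Fin r) : colKey w c D k = J ↔ ∀ j, ¬ stamp c D j ⊆ w k := by
  constructor
  · intro hk j hj
    have := colKey_le_of_subset hj
    rw [hk] at this
    exact absurd this (not_le.mpr j.2)
  · intro hnone
    have hk : ¬ (stampsIn w c D k).Nonempty := fun ⟨j, hj⟩ => hnone j (mem_stampsIn.mp hj)
    rw [colKey, dif_neg hk]

/-- Key `j < J` characterises the columns whose FIRST contained stamp is `E_j` (first fit). -/
theorem colKey_eq_iff (k : Fin r) (j : Fin J) :
    colKey w c D k = j ↔ stamp c D j ⊆ w k ∧ ∀ j', j' < j → ¬ stamp c D j' ⊆ w k := by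
  constructor
  · intro hk
    have hne : (stampsIn w c D k).Nonempty := by
      by_contra hne
      rw [colKey, dif_neg hne] at hk
      exact absurd hk.symm j.2.ne
    rw [colKey, dif_pos hne] at hk
    have hkj : (stampsIn w c D k).min' hne = j := Fin.ext hk
    refine ⟨mem_stampsIn.mp (hkj ▸ Finset.min'_mem _ hne), fun j' hj' hsub => ?_⟩
    have hle := Finset.min'_le (stampsIn w c D k) j' (mem_stampsIn.mpr hsub)
    rw [hkj] at hle
    exact absurd hj' (not_lt.mpr hle)
  · rintro ⟨hsub, hmin⟩
    have hne : (stampsIn w c D k).Nonempty := ⟨j, mem_stampsIn.mpr hsub⟩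
    rw [colKey, dif_pos hne]
    have hkj : (stampsIn w c D k).min' hne = j := by
      refine le_antisymm (Finset.min'_le _ _ (mem_stampsIn.mpr hsub)) ?_
      by_contra hlt
      exact hmin _ (not_le.mp hlt) (mem_stampsIn.mp (Finset.min'_mem _ hne))
    rw [hkj]

/-- The peeled `x`-set of a link row. -/
theorem peelU_of_mem {i : Fin r} (hi : a ∈ u i) : peelU u a B cls i = ((u i).erase a) \ B (cls i) := by
  rw [peelU, if_pos hi]

/-- The peeled `x`-set of a deletion row. -/
theorem peelU_of_not_mem {i : Fin r} (hi : a ∉ u i) : peelU u a B cls i = u i := by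
  rw [peelU, if_neg hi]

/-- The shift of a peeled link row is the stamp of its class. -/
theorem peelE_of_mem {i : Fin r} (hi : a ∈ u i) : peelE u a c D cls i = stamp c D (cls i) := by
  rw [peelE, if_pos hi, Finset.empty_union, stamp]

/-- A deletion row keeps the empty shift. -/
theorem peelE_of_not_mem {i : Fin r} (hi : a ∉ u i) : peelE u a c D cls i = ∅ := by
  rw [peelE, if_neg hi]

/-- **Support of the peeled layout**: a nonzero peeled entry has column key at most the row key. -/
theorem colKey_le_rowKey_of_ne_zero (s : ℕ) {i k : Fin r}
    (hne : genEntry s h (peelU u a B cls i) (peelE u a c D cls i) (w k) ≠ 0) :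
    colKey w c D k ≤ rowKey u a cls i := by
  by_cases hi : a ∈ u i
  · rw [rowKey_of_mem hi]
    rw [peelE_of_mem hi, genEntry] at hne
    by_cases hsub : stamp c D (cls i) ⊆ w k
    · exact colKey_le_of_subset hsub
    · rw [if_neg hsub] at hne
      exact absurd rfl hne
  · rw [rowKey_of_not_mem hi]
    exact colKey_le k

/-! ## 2. The size condition aligns row keys and column keys -/

/-- The fibre counts of the two keys agree at every value, given the DTS size condition for the classes `j < J`. -/
theorem card_rowKey_eq_card_colKey
    (hcount : ∀ j : Fin J, (univ.filter fun i => a ∈ u i ∧ cls i = j).card =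
      (univ.filter fun k => stamp c D j ⊆ w k ∧ ∀ j', j' < j → ¬ stamp c D j' ⊆ w k).card)
    (v : ℕ) : (univ.filter fun i => rowKey u a cls i = v).card = (univ.filter fun k => colKey w c D k = v).card := by
  have hlt : ∀ v, v < J →
      (univ.filter fun i => rowKey u a cls i = v).card = (univ.filter fun k => colKey w c D k = v).card := by
    intro v hv
    have h1 : (univ.filter fun i => rowKey u a cls i = v) = univ.filter fun i => a ∈ u i ∧ cls i = ⟨v, hv⟩ :=
      Finset.filter_congr (fun i _ => rowKey_eq_iff i ⟨v, hv⟩)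
    have h2 : (univ.filter fun k => colKey w c D k = v) =
        univ.filter fun k => stamp c D ⟨v, hv⟩ ⊆ w k ∧ ∀ j', j' < ⟨v, hv⟩ → ¬ stamp c D j' ⊆ w k :=
      Finset.filter_congr (fun k _ => colKey_eq_iff k ⟨v, hv⟩)
    rw [h1, h2, hcount]
  rcases lt_trichotomy v J with hv | hv | hv
  · exact hlt v hv
  · rw [hv]
    -- complement count: both keys take values in `range (J + 1)`
    have hr : (univ : Finset (Fin r)).card = ∑ b ∈ Finset.range (J + 1), (univ.filter fun i => rowKey u a cls i = b).card :=
      Finset.card_eq_sum_card_fiberwise (fun i _ => Finset.mem_coe.mpr (Finset.mem_range.mpr (Nat.lt_succ_of_le (rowKey_le i))))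
    have hc : (univ : Finset (Fin r)).card = ∑ b ∈ Finset.range (J + 1), (univ.filter fun k => colKey w c D k = b).card :=
      Finset.card_eq_sum_card_fiberwise (fun k _ => Finset.mem_coe.mpr (Finset.mem_range.mpr (Nat.lt_succ_of_le (colKey_le k))))
    rw [Finset.sum_range_succ] at hr hc
    have hsum : ∑ b ∈ Finset.range J, (univ.filter fun i => rowKey u a cls i = b).card =
        ∑ b ∈ Finset.range J, (univ.filter fun k => colKey w c D k = b).card :=
      Finset.sum_congr rfl (fun b hb => hlt b (Finset.mem_range.mp hb))
    omega
  · have h1 : (univ.filter fun i => rowKey u a cls i = v) = ∅ :=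
      Finset.filter_eq_empty_iff.mpr (fun i _ hi => absurd (hi ▸ rowKey_le i) (not_le.mpr hv))
    have h2 : (univ.filter fun k => colKey w c D k = v) = ∅ :=
      Finset.filter_eq_empty_iff.mpr (fun k _ hk => absurd (hk ▸ colKey_le k) (not_le.mpr hv))
    rw [h1, h2]

end DTS

end DTPeel

end

end Summit.ValiantsHypothesis.ValiantsHypothesis.Theorems.BarrierLever.AnchoredPeeling
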